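import Summits.Ventures.PercRepro.Night2ThreeFatCount

/-!
# PercRepro — THE GENERAL SERIES-CLASS COUNT (night-2, gen 23)

`seriesFamily X ρ Cs` = the `ρ`-subsets of `X` missing at most one point of every class of the list `Cs`;
`cntSeries ρ s ts` = `C(s, ρ)` for `[]` and `cntSeries (ρ − t) (s − t) ts + t · cntSeries (ρ + 1 − t) (s − t) ts`
for `t :: ts` (guarded).  `cntSeries_succ_succ_le` is Pascal's rule for the count (the key to a class with a point
outside the target), `card_seriesFamily_le` the bound `#seriesFamily X ρ Cs ≤ cntSeries ρ |X| (sizes)` by the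
injections `T ↦ T ∖ C` (its form for the covering bases is `Night2SeriesClassesBases`).
-/

namespace PercRepro.Shadow

open Finset

variable {α : Type*} [DecidableEq α]

/-- The `ρ`-subsets of `X` missing at most one point of every class. -/
def seriesFamily (X : Finset α) (ρ : ℕ) (Cs : List (Finset α)) : Finset (Finset α) :=
  (X.powersetCard ρ).filter (fun T => ∀ C ∈ Cs, (C \ T).card ≤ 1)

/-- The series-class count. -/
def cntSeries : ℕ → ℕ → List ℕ → ℕ
  | ρ, s, [] => s.choose ρ
  | ρ, s, (t :: ts) =>
      (if t ≤ ρ then cntSeries (ρ - t) (s - t) ts else 0) +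
        t * (if t ≤ ρ + 1 then cntSeries (ρ + 1 - t) (s - t) ts else 0)

/-- The count with no classes is the binomial coefficient. -/
theorem cntSeries_nil (ρ s : ℕ) : cntSeries ρ s [] = s.choose ρ := rfl

/-- The recursion of the count (unfolding). -/
theorem cntSeries_cons (ρ s t : ℕ) (ts : List ℕ) :
    cntSeries ρ s (t :: ts) = (if t ≤ ρ then cntSeries (ρ - t) (s - t) ts else 0) +
      t * (if t ≤ ρ + 1 then cntSeries (ρ + 1 - t) (s - t) ts else 0) := rfl

/-- At `ρ = 0` the count does not grow with `s`. -/
theorem cntSeries_zero_succ_le (ts : List ℕ) : ∀ s : ℕ, cntSeries 0 (s + 1) ts ≤ cntSeries 0 s ts := by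
  induction ts with
  | nil => intro s; simp [cntSeries_nil]
  | cons t ts ih =>
    intro s
    simp only [cntSeries_cons]
    rcases t with _ | _ | t
    · -- t = 0
      simp only [Nat.le_refl, ite_true, Nat.sub_zero, Nat.zero_mul, Nat.add_zero, Nat.zero_le, Nat.sub_self]
      exact ih s
    · -- t = 1
      simp only [Nat.one_le_iff_ne_zero, ne_eq, not_true_eq_false, ite_false, Nat.le_refl, ite_true, Nat.zero_add,
        Nat.one_mul, Nat.add_sub_cancel, Nat.sub_self]
      rcases s with _ | s
      · simp
      · rw [Nat.add_sub_cancel]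
        exact ih s
    · -- t ≥ 2
      simp

/-- **Pascal's rule for the series-class count**:
`cntSeries (ρ + 1) (s + 1) ts ≤ cntSeries (ρ + 1) s ts + cntSeries ρ s ts`. -/
theorem cntSeries_succ_succ_le (ts : List ℕ) : ∀ ρ s : ℕ,
    cntSeries (ρ + 1) (s + 1) ts ≤ cntSeries (ρ + 1) s ts + cntSeries ρ s ts := by
  induction ts with
  | nil =>
    intro ρ s
    simp only [cntSeries_nil]
    rw [Nat.choose_succ_succ, Nat.add_comm]
  | cons t ts ih =>
    intro ρ s
    simp only [cntSeries_cons]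
    rcases Nat.lt_or_ge s t with hst | hst
    · -- the class is larger than the target: both sides see `s − t = 0`
      rw [show s + 1 - t = 0 by omega, show s - t = 0 by omega]
      exact Nat.le_add_right _ _
    obtain ⟨s', rfl⟩ : ∃ s', s = s' + t := ⟨s - t, by omega⟩
    rw [show s' + t + 1 - t = s' + 1 by omega, Nat.add_sub_cancel]
    rcases (show t ≤ ρ ∨ t = ρ + 1 ∨ t = ρ + 2 ∨ ρ + 3 ≤ t by omega) with h | rfl | rfl | h
    · have c1 : t ≤ ρ + 1 := by omega
      have c2 : t ≤ ρ + 1 + 1 := by omega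
      simp only [c1, c2, h, ↓reduceIte]
      obtain ⟨ρ', rfl⟩ : ∃ ρ', ρ = ρ' + t := ⟨ρ - t, by omega⟩
      rw [show ρ' + t + 1 - t = ρ' + 1 by omega, show ρ' + t + 1 + 1 - t = ρ' + 1 + 1 by omega, Nat.add_sub_cancel]
      have h1 := ih ρ' s'
      have h2 := ih (ρ' + 1) s'
      calc cntSeries (ρ' + 1) (s' + 1) ts + t * cntSeries (ρ' + 1 + 1) (s' + 1) ts
          ≤ (cntSeries (ρ' + 1) s' ts + cntSeries ρ' s' ts) +
              t * (cntSeries (ρ' + 1 + 1) s' ts + cntSeries (ρ' + 1) s' ts) :=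
            Nat.add_le_add h1 (Nat.mul_le_mul_left t h2)
        _ = _ := by ring
    · have c1 : ρ + 1 ≤ ρ + 1 + 1 := by omega
      have c3 : ¬ ρ + 1 ≤ ρ := by omega
      simp only [le_refl, c1, c3, ↓reduceIte, Nat.sub_self, show ρ + 1 + 1 - (ρ + 1) = 1 by omega]
      have h1 := cntSeries_zero_succ_le ts s'
      have h2 := ih 0 s'
      rw [Nat.zero_add] at h2
      calc cntSeries 0 (s' + 1) ts + (ρ + 1) * cntSeries 1 (s' + 1) ts
          ≤ cntSeries 0 s' ts + (ρ + 1) * (cntSeries 1 s' ts + cntSeries 0 s' ts) :=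
            Nat.add_le_add h1 (Nat.mul_le_mul_left (ρ + 1) h2)
        _ = _ := by ring
    · have c1 : ¬ ρ + 2 ≤ ρ + 1 := by omega
      have c2 : ρ + 2 ≤ ρ + 1 + 1 := by omega
      have c3 : ¬ ρ + 2 ≤ ρ := by omega
      simp only [c1, c2, c3, ↓reduceIte, show ρ + 1 + 1 - (ρ + 2) = 0 by omega, Nat.zero_add]
      exact Nat.mul_le_mul_left (ρ + 2) (cntSeries_zero_succ_le ts s')
    · have c1 : ¬ t ≤ ρ + 1 := by omega
      have c2 : ¬ t ≤ ρ + 1 + 1 := by omega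
      have c3 : ¬ t ≤ ρ := by omega
      simp only [c1, c2, c3, ↓reduceIte, Nat.mul_zero, Nat.add_zero, le_refl]

/-- Membership in the series family: a `ρ`-subset of `X` missing at most one point of every class. -/
theorem mem_seriesFamily {X : Finset α} {ρ : ℕ} {Cs : List (Finset α)} {T : Finset α} :
    T ∈ seriesFamily X ρ Cs ↔ (T ⊆ X ∧ T.card = ρ) ∧ ∀ C ∈ Cs, (C \ T).card ≤ 1 := by
  unfold seriesFamily
  rw [Finset.mem_filter, Finset.mem_powersetCard]

/-- Removing a class disjoint from `C'` does not change the missed part of `C'`. -/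
theorem sdiff_sdiff_of_disjoint {C C' T : Finset α} (h : Disjoint C C') : C' \ (T \ C) = C' \ T := by
  ext w
  simp only [Finset.mem_sdiff, not_and, not_not]
  constructor
  · rintro ⟨hw, hw'⟩
    exact ⟨hw, fun hT => Finset.disjoint_right.1 h hw (hw' hT)⟩
  · rintro ⟨hw, hw'⟩
    exact ⟨hw, fun hT => absurd hT hw'⟩

/-- **The injection `T ↦ T ∖ C`** from the members of the family with a prescribed trace `A` on the class `C`
(`T ∩ C = A`) into the family of the remaining classes on `X ∖ C`; no member when `|A| > ρ`. -/
theorem card_filter_inter_eq_le (X C A : Finset α) (ρ : ℕ) (Cs : List (Finset α))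
    (hdisj : ∀ C' ∈ Cs, Disjoint C C') :
    ((seriesFamily X ρ (C :: Cs)).filter (fun T => T ∩ C = A)).card ≤
      if A.card ≤ ρ then (seriesFamily (X \ C) (ρ - A.card) Cs).card else 0 := by
  by_cases hA : A.card ≤ ρ
  · rw [if_pos hA]
    apply Finset.card_le_card_of_injOn (fun T => T \ C)
    · intro T hT
      rw [Finset.mem_coe, Finset.mem_filter, mem_seriesFamily] at hT
      obtain ⟨⟨⟨hTX, hTc⟩, hmiss⟩, hTA⟩ := hT
      rw [Finset.mem_coe, mem_seriesFamily]
      refine ⟨⟨Finset.sdiff_subset_sdiff hTX le_rfl, ?_⟩, ?_⟩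
      · have := Finset.card_sdiff_add_card_inter T C
        rw [hTA, hTc] at this
        show (T \ C).card = ρ - A.card
        omega
      · intro C' hC'
        rw [sdiff_sdiff_of_disjoint (hdisj C' hC')]
        exact hmiss C' (List.mem_cons_of_mem C hC')
    · intro T hT T' hT' heq
      rw [Finset.mem_coe, Finset.mem_filter] at hT hT'
      simp only at heq
      calc T = T \ C ∪ T ∩ C := (Finset.sdiff_union_inter T C).symm
        _ = T' \ C ∪ T' ∩ C := by rw [heq, hT.2, hT'.2]
        _ = T' := Finset.sdiff_union_inter T' C
  · rw [if_neg hA]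
    apply Nat.le_of_eq
    rw [Finset.card_eq_zero, Finset.filter_eq_empty_iff]
    intro T hT hTA
    rw [mem_seriesFamily] at hT
    apply hA
    rw [← hTA, ← hT.1.2]
    exact Finset.card_le_card Finset.inter_subset_left

/-- The members of the family have trace `C` or `C ∖ {v}` on the class `C`. -/
theorem seriesFamily_cons_subset (X C : Finset α) (ρ : ℕ) (Cs : List (Finset α)) :
    seriesFamily X ρ (C :: Cs) ⊆
      (seriesFamily X ρ (C :: Cs)).filter (fun T => T ∩ C = C) ∪
        C.biUnion (fun v => (seriesFamily X ρ (C :: Cs)).filter (fun T => T ∩ C = C.erase v)) := by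
  intro T hT
  have hmiss : (C \ T).card ≤ 1 := (mem_seriesFamily.1 hT).2 C List.mem_cons_self
  rw [Finset.mem_union, Finset.mem_biUnion]
  rcases Nat.le_one_iff_eq_zero_or_eq_one.1 hmiss with h0 | h1
  · left
    rw [Finset.mem_filter]
    refine ⟨hT, ?_⟩
    rw [Finset.card_eq_zero, Finset.sdiff_eq_empty_iff_subset] at h0
    exact Finset.inter_eq_right.2 h0
  · right
    obtain ⟨v, hv⟩ := Finset.card_eq_one.1 h1
    have hvC : v ∈ C := by
      have : v ∈ C \ T := by rw [hv]; exact Finset.mem_singleton_self v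
      exact (Finset.mem_sdiff.1 this).1
    refine ⟨v, hvC, Finset.mem_filter.2 ⟨hT, ?_⟩⟩
    ext w
    simp only [Finset.mem_inter, Finset.mem_erase]
    constructor
    · rintro ⟨hwT, hwC⟩
      refine ⟨fun hwv => ?_, hwC⟩
      have : v ∈ C \ T := by rw [hv]; exact Finset.mem_singleton_self v
      exact (Finset.mem_sdiff.1 this).2 (hwv ▸ hwT)
    · rintro ⟨hwv, hwC⟩
      refine ⟨?_, hwC⟩
      by_contra hwT
      have : w ∈ C \ T := Finset.mem_sdiff.2 ⟨hwC, hwT⟩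
      rw [hv, Finset.mem_singleton] at this
      exact hwv this

/-- **The recursion of the series-class count** (the class `C` first; valid whether or not `C ⊆ X`). -/
theorem card_seriesFamily_cons_le (X C : Finset α) (ρ : ℕ) (Cs : List (Finset α)) (hC : 1 ≤ C.card)
    (hdisj : ∀ C' ∈ Cs, Disjoint C C') :
    (seriesFamily X ρ (C :: Cs)).card ≤
      (if C.card ≤ ρ then (seriesFamily (X \ C) (ρ - C.card) Cs).card else 0) +
        C.card * (if C.card ≤ ρ + 1 then (seriesFamily (X \ C) (ρ + 1 - C.card) Cs).card else 0) := by
  have h1 := Finset.card_le_card (seriesFamily_cons_subset X C ρ Cs)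
  have h2 := Finset.card_union_le ((seriesFamily X ρ (C :: Cs)).filter (fun T => T ∩ C = C))
    (C.biUnion (fun v => (seriesFamily X ρ (C :: Cs)).filter (fun T => T ∩ C = C.erase v)))
  have h3 := Finset.card_biUnion_le (s := C)
    (t := fun v => (seriesFamily X ρ (C :: Cs)).filter (fun T => T ∩ C = C.erase v))
  have h4 := card_filter_inter_eq_le X C C ρ Cs hdisj
  have h5 : ∑ v ∈ C, ((seriesFamily X ρ (C :: Cs)).filter (fun T => T ∩ C = C.erase v)).card ≤
      ∑ _v ∈ C, (if C.card ≤ ρ + 1 then (seriesFamily (X \ C) (ρ + 1 - C.card) Cs).card else 0) := by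
    apply Finset.sum_le_sum
    intro v hv
    have := card_filter_inter_eq_le X C (C.erase v) ρ Cs hdisj
    rw [Finset.card_erase_of_mem hv] at this
    by_cases hc : C.card ≤ ρ + 1
    · rw [if_pos hc]
      rw [if_pos (by omega), show ρ - (C.card - 1) = ρ + 1 - C.card by omega] at this
      exact this
    · rw [if_neg hc]
      rw [if_neg (by omega)] at this
      exact this
  rw [Finset.sum_const, smul_eq_mul] at h5
  omega

/-- The family for no classes is the full `ρ`-power set. -/
theorem seriesFamily_nil (X : Finset α) (ρ : ℕ) : seriesFamily X ρ [] = X.powersetCard ρ := by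
  unfold seriesFamily
  apply Finset.filter_true_of_mem
  intro T _ C hC
  exact absurd hC (List.not_mem_nil)

/-- A class with two points outside the target has no member. -/
theorem seriesFamily_eq_empty_of_two_le (X C : Finset α) (ρ : ℕ) (Cs : List (Finset α))
    (h : 2 ≤ (C \ X).card) : seriesFamily X ρ (C :: Cs) = ∅ := by
  rw [Finset.eq_empty_iff_forall_notMem]
  intro T hT
  rw [mem_seriesFamily] at hT
  have h1 : (C \ X).card ≤ (C \ T).card := Finset.card_le_card (Finset.sdiff_subset_sdiff le_rfl hT.1.1)
  have h2 := hT.2 C List.mem_cons_self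
  omega

/-- **THE GENERAL SERIES-CLASS COUNT**: for pairwise disjoint classes of size `≥ 1`,
`#seriesFamily X ρ Cs ≤ cntSeries ρ |X| (Cs.map card)`. -/
theorem card_seriesFamily_le (Cs : List (Finset α)) : ∀ (X : Finset α) (ρ : ℕ),
    Cs.Pairwise Disjoint → (∀ C ∈ Cs, 1 ≤ C.card) →
    (seriesFamily X ρ Cs).card ≤ cntSeries ρ X.card (Cs.map Finset.card) := by
  induction Cs with
  | nil =>
    intro X ρ _ _
    rw [seriesFamily_nil, Finset.card_powersetCard, List.map_nil, cntSeries_nil]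
  | cons C Cs ih =>
    intro X ρ hpw hsz
    have hdisj : ∀ C' ∈ Cs, Disjoint C C' := (List.pairwise_cons.1 hpw).1
    have hpw' : Cs.Pairwise Disjoint := (List.pairwise_cons.1 hpw).2
    have hsz' : ∀ C' ∈ Cs, 1 ≤ C'.card := fun C' hC' => hsz C' (List.mem_cons_of_mem C hC')
    have hC : 1 ≤ C.card := hsz C List.mem_cons_self
    rw [List.map_cons, cntSeries_cons]
    have hrec := card_seriesFamily_cons_le X C ρ Cs hC hdisj
    have hXC := Finset.card_sdiff_add_card_inter X C
    have hCX := Finset.card_sdiff_add_card_inter C X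
    rw [Finset.inter_comm] at hCX
    -- three cases on the points of the class outside the target
    rcases (show (C \ X).card = 0 ∨ (C \ X).card = 1 ∨ 2 ≤ (C \ X).card by omega) with h0 | h1 | h2
    · -- the class lies inside the target
      have hs : (X \ C).card = X.card - C.card := by omega
      have i1 := ih (X \ C) (ρ - C.card) hpw' hsz'
      have i2 := ih (X \ C) (ρ + 1 - C.card) hpw' hsz'
      rw [hs] at i1 i2
      refine hrec.trans (Nat.add_le_add ?_ (Nat.mul_le_mul_left _ ?_))
      · split_ifs <;> simp only [i1, le_refl]
      · split_ifs <;> simp only [i2, le_refl]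
    · -- exactly one point `w` of the class is outside: only the trace `C ∖ {w}` occurs
      obtain ⟨w, hw⟩ := Finset.card_eq_one.1 h1
      have hwC : w ∈ C := by
        have : w ∈ C \ X := by rw [hw]; exact Finset.mem_singleton_self w
        exact (Finset.mem_sdiff.1 this).1
      have hsub : seriesFamily X ρ (C :: Cs) ⊆
          (seriesFamily X ρ (C :: Cs)).filter (fun T => T ∩ C = C.erase w) := by
        intro T hT
        rw [Finset.mem_filter]
        refine ⟨hT, ?_⟩
        have hT' := mem_seriesFamily.1 hT
        have hmiss := hT'.2 C List.mem_cons_self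
        have hwT : w ∉ T := fun h => by
          have : w ∈ C \ X := by rw [hw]; exact Finset.mem_singleton_self w
          exact (Finset.mem_sdiff.1 this).2 (hT'.1.1 h)
        ext u
        simp only [Finset.mem_inter, Finset.mem_erase]
        constructor
        · rintro ⟨huT, huC⟩
          exact ⟨fun h => hwT (h ▸ huT), huC⟩
        · rintro ⟨huw, huC⟩
          refine ⟨?_, huC⟩
          by_contra huT
          have hsub2 : ({w, u} : Finset α) ⊆ C \ T := by
            intro v hv
            simp only [Finset.mem_insert, Finset.mem_singleton] at hv
            rcases hv with rfl | rfl
            · exact Finset.mem_sdiff.2 ⟨hwC, hwT⟩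
            · exact Finset.mem_sdiff.2 ⟨huC, huT⟩
          have := Finset.card_le_card hsub2
          rw [Finset.card_pair (Ne.symm huw)] at this
          omega
      have hb := (Finset.card_le_card hsub).trans (card_filter_inter_eq_le X C (C.erase w) ρ Cs hdisj)
      rw [Finset.card_erase_of_mem hwC] at hb
      by_cases hρ : C.card - 1 ≤ ρ
      · rw [if_pos hρ] at hb
        rcases Nat.lt_or_ge X.card C.card with hlt | hge
        · -- the whole target lies in the class
          have hs : (X \ C).card = X.card - C.card := by omega
          have i2 := ih (X \ C) (ρ - (C.card - 1)) hpw' hsz'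
          rw [hs] at i2
          have hb2 := hb.trans i2
          rw [show ρ - (C.card - 1) = ρ + 1 - C.card by omega] at hb2
          rw [if_pos (by omega : C.card ≤ ρ + 1)]
          have hmul : cntSeries (ρ + 1 - C.card) (X.card - C.card) (Cs.map Finset.card) ≤
              C.card * cntSeries (ρ + 1 - C.card) (X.card - C.card) (Cs.map Finset.card) :=
            Nat.le_mul_of_pos_left _ hC
          omega
        · have hs : (X \ C).card = X.card - C.card + 1 := by omega
          have i2 := ih (X \ C) (ρ - (C.card - 1)) hpw' hsz'
          rw [hs] at i2
          have hb2 := hb.trans i2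
          rcases (show C.card ≤ ρ ∨ C.card = ρ + 1 by omega) with hle | heq
          · -- Pascal for the count
            have e : ρ - (C.card - 1) = (ρ - C.card) + 1 := by omega
            rw [e] at hb2
            have hp := cntSeries_succ_succ_le (Cs.map Finset.card) (ρ - C.card) (X.card - C.card)
            rw [if_pos hle, if_pos (by omega : C.card ≤ ρ + 1), show ρ + 1 - C.card = ρ - C.card + 1 by omega]
            have hmul : cntSeries (ρ - C.card + 1) (X.card - C.card) (Cs.map Finset.card) ≤
                C.card * cntSeries (ρ - C.card + 1) (X.card - C.card) (Cs.map Finset.card) :=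
              Nat.le_mul_of_pos_left _ hC
            omega
          · have e : ρ - (C.card - 1) = 0 := by omega
            rw [e] at hb2
            have hz := cntSeries_zero_succ_le (Cs.map Finset.card) (X.card - C.card)
            rw [if_neg (by omega : ¬ C.card ≤ ρ), if_pos (by omega : C.card ≤ ρ + 1),
              show ρ + 1 - C.card = 0 by omega]
            have hmul : cntSeries 0 (X.card - C.card) (Cs.map Finset.card) ≤
                C.card * cntSeries 0 (X.card - C.card) (Cs.map Finset.card) :=
              Nat.le_mul_of_pos_left _ hC
            omega
      · rw [if_neg hρ] at hb
        omega
    · rw [seriesFamily_eq_empty_of_two_le X C ρ Cs h2, Finset.card_empty]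
      exact Nat.zero_le _

end PercRepro.Shadow
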